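import Summits.QuantumFields.YangMills.Theorems.BalabanUVNodesN12AtRecord13TermPinnedLambda
import Literature.MathematicalPhysics.QuantumFieldTheory.Balaban1983to89.Node00.Record13LettersOfThm1CCMW

/-!
# BalabanUVNodes ∕ N12 — N12's Λ-PINNED ROW IN NODE O's WINDOW AT THE WINDOW-EDITION WITNESS `θ₁₅ᶜᶜᴹ(jM;γ) = theta13OfThm1CCMW F N jM γ ε₀ ε₂₉ B₃ B₃' a₀ a₁` (dag-n21-c A1ʷ):
# 12I's small-window leaf (flow inputs, coupling step, levels from the run's window `]0, γ]`) — uninstantiable at every earlier witness (`γ = ½`) — with the β letters FED BY STUB 3ʷ's BOX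
# (Track A, DAG node N12 = [B15, Balaban1989LargeFieldI] CMP **122** (1989) 175–202; cluster K1 — K1⁷ `StabilityBAtRecordR13SepCoPH` = stmt-QuantumFields-20542, helper; seat `pub-ymgap-dag-n12-d`
# g14 (R134 s2 «knit at the record»), 2026-08-27; count-neutral, CONDITIONAL, NOT a discharge)

HONEST FRAMING.  Count-neutral kernel BOOKKEEPING BY NAME: 12I `…N12AtRecord13TermPinnedLambda` §1 ★★ `b15Leaf_WOfRecord₁₃_pinAllΛ_N0_liveRepin₁₃_of_massLive_of_hasResiduals_of_inInterval` (this seat g8;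
generic `Θ` with K0b's residuals; its HONEST REACH note: «NOT instantiated at θ₁₅ᶜ — `SmallnessFor θ₁₅ᶜ.γ …` unsatisfiable at `γ = ½`») INSTANTIATED at dag-n21-c g12's window edition (A1ʷ
`Node00.Record13NumericsOfThm1CCMW`: `stage12NumericsOfThm1CCMW := {stage12NumericsOfThm1CCM … with γ := γ}`, `theta13OfThm1CCMW := theta13LiveOfNumerics …`; LOCATED-WINDOW bus l.22290, plan g77
WINDOW-WORD l.22324: V16's witness), with: `β ≥ 0` along the run's history ⟸ stub 3ʷ's lower box through A2ʷ `betaLowerH_theta13OfThm1CCMW_of_half` and dag-n12-e's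
`betaAlongHistory_nonneg_of_betaLowerH`; the (2.7) bound `BetaUpperH β′ γ` ⟸ stub 3ʷ's upper box through A2ʷ `betaUpperH_theta13OfThm1CCMW_of_half`; `1 ≤ r` (`r = 1`), `0 ≤ A₀` (K0a
`A0OfThm1CC1_nonneg`), `0 < M = L^{jM}`, `θ.γ = γ` by `rfl`; and the flow-profile letter `γ·p0Profile A₀ 1 γ ≤ 1∕10` PROVED (§0: `γ·log γ⁻² ≤ 1` on `]0,½]`, `A₀ᶜᶜ¹ ≤ A₀ᶜ ≤ 1∕16` by K0a
`A0OfThm1CC1_le` ∕ `A0OfThm1C_le_sixteenth`).  WHAT IT SHOWS: at the K0 witness of the window edition, N12's located per-run inputs SHRINK to — live-mass (NODE 00), Prop. 1 (dag-n12-c ∕ 12Q⁵: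
(J1)∕(L2) + [15] from stub 1), the run's window `Step.InInterval γ (kSel P + 1) g` (the K1 world's own, `w.γ ≤ γ`), NODE O's smallness `SmallnessFor γ β′ β₀ L 1` with `β₀ ≤ ½` ([I] §1 «γ sufficiently
small»; β′ = stub 3ʷ's upper constant), the levels `N₀ ≤ N P`, `N₀ ≤ kSel P + 1`, the situation's residual numbers, print's two p. 200 conditions, `Λ ≠ ∅`, the four ℍ-leaves + (1.80) (N07): NO
flow display (2.8a), NO coupling-step display, NO `ε`-range display, NO `hlog`.  Stub 3ʷ's box is a HYPOTHESIS (NODE O's; sign of β UNPRINTED, [II] p.355); nothing of Bałaban's is asserted;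
N12 is NOT discharged; no node is discharged; K0⁷ ∕ K1⁷ NOT closed; counts unmoved (discharged 5∕27 · Track A 5∕28).  ONE finite four-torus programme at fixed `ε = L^{-K}` — nothing
continuum ∕ ℝ⁴ ∕ OS ∕ mass gap ∕ Clay.  No `sorry`, `def`, `instance`, `notation`.

Sources: [Balaban1989LargeFieldI] (0.2)–(0.6) p.176, (1.73) p.192, Prop. 1 (1.78) p.194, (1.80) p.195, (1.89) p.198, (1.91)–(1.102) pp.199–201; [Balaban1988Convergent] (2.1)–(2.8)
pp.254–256, (2.10)–(2.12) p.256, (2.13) p.257, (3.16)–(3.25) pp.268–270; [Balaban1987RG1] Thm 1 p.259, (0.20)–(0.21) p.256, §1 (1.20)–(1.22) p.264; [Balaban1989LargeFieldII] (1.4) p.357.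
-/

noncomputable section

open MeasureTheory
open scoped Matrix.Norms.L2Operator

namespace Summit.QuantumFields.YangMills.BalabanUVNodes.N12AtTheta13OfThm1CCMWSmallWindow

open Literature.MathematicalPhysics.QuantumFieldTheory.Balaban1983to89
open Literature.MathematicalPhysics.QuantumFieldTheory.Balaban1983to89.T4Continuum (T4Family)
open Literature.MathematicalPhysics.QuantumFieldTheory.Balaban1983to89.DagBinding (PrintedCarriers15 B15Leaf)
open Literature.MathematicalPhysics.QuantumFieldTheory.Balaban1983to89.Node00
open B15Claim189Assembly (Setting189 new189 chiPP dom half)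
open B15 (Prop1Printed Ineq180)
open B15.BasicStep (Claim189)
open B15.PrelimIntegrations (Ineq191 Ineq195)
open B15Chi124DetSets (E124)
open B15DeterminingSets (MSField)
open B14DomainGeom (Pt)
open B8Eq17ClassAkV1 (plaqsOf)
open GaugeGroup (dist1)
open GaugeField (plaqHol)
open B15Claim189PrintedConditions (omegaOfChain)
open B15Claim189PinsOfHistory (sitOfHist N0OfRecord₁₃ D189OfHist)
open B15Claim189LambdaPin (enlD h189_pinD189ΛH_of_h180_of_flow h189_pinD189ΛH₁₃_of_h180_of_inInterval)
open FlowStep (prefixOf BetaUpperH BetaLowerH)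
open B14FlowStep (SmallnessFor)
open Summit.QuantumFields.YangMills.BalabanUVNodes.N12AtRecord13OfResiduals (b15Leaf_WOfRecord₁₃_liveRepin₁₃_of_massLive_of_hasResiduals)
open Summit.QuantumFields.YangMills.BalabanUVNodes.N12AtRecord13TermPinned (new189_pinAllTH_liveRepin₁₃_one_zero)

open B15Claim189N0OfRecord (betaAlongHistory_nonneg_of_betaLowerH)
open Summit.QuantumFields.YangMills.BalabanUVNodes.N12AtRecord13TermPinnedLambda (b15Leaf_WOfRecord₁₃_pinAllΛ_N0_liveRepin₁₃_of_massLive_of_hasResiduals_of_inInterval)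

variable {N : ℕ} [NeZero N] {F : T4Family}

/-! ## §0 The one numeric fact of the window: `γ · A₀ · log γ⁻² ≤ 1∕10` for `0 < γ ≤ ½`, `0 ≤ A₀ ≤ 1∕16` -/

section Numeric

/-- **`γ·log γ⁻² ≤ 1` ON `]0, ½]`**: with `x := (2γ)⁻¹ ≥ 1`, `log γ⁻² = 2 log 2 + 2 log x ≤ 2 log 2 + 2(x − 1)`, so `γ·log γ⁻² ≤ 1 − 2γ(1 − log 2) ≤ 1` (`log 2 < 1`). [folklore] -/
theorem gamma_mul_log_inv_sq_le_one {γ : ℝ} (hγ0 : 0 < γ) (hγh : γ ≤ 1 / 2) : γ * Real.log (γ ^ 2)⁻¹ ≤ 1 := by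
  have h1 : Real.log (γ ^ 2)⁻¹ = 2 * Real.log γ⁻¹ := by
    rw [Real.log_inv, Real.log_pow, Real.log_inv]; push_cast; ring
  have hx : Real.log γ⁻¹ ≤ Real.log 2 + (γ⁻¹ / 2 - 1) := by
    have hmul : Real.log γ⁻¹ = Real.log 2 + Real.log (γ⁻¹ / 2) := by
      rw [← Real.log_mul (by norm_num) (by positivity)]; congr 1; ring
    have hx' : Real.log (γ⁻¹ / 2) ≤ γ⁻¹ / 2 - 1 := Real.log_le_sub_one_of_pos (by positivity)
    rw [hmul]; linarith
  have h2 : Real.log 2 ≤ 1 := by have := Real.log_two_lt_d9; linarith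
  have hγinv : γ * γ⁻¹ = 1 := mul_inv_cancel₀ hγ0.ne'
  have h3 : γ * Real.log γ⁻¹ ≤ γ * (Real.log 2 + (γ⁻¹ / 2 - 1)) := mul_le_mul_of_nonneg_left hx hγ0.le
  have h4 : γ * Real.log 2 ≤ γ * 1 := mul_le_mul_of_nonneg_left h2 hγ0.le
  rw [h1]
  nlinarith [h3, h4, hγinv, hγ0.le]

/-- **THE (2.7)∕FLOW NUMERIC INPUT `γ · p0Profile A₀ 1 γ ≤ 1∕10` OF 12I's SMALL-WINDOW ROW HOLDS ON NODE O's WINDOW** for `p₀ = 1`, `0 ≤ A₀ ≤ 1∕16` (the collared members' `A₀ᶜᶜ¹`):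
`γ·A₀·log γ⁻² ≤ A₀ ≤ 1∕16`. [cite: Balaban1988Convergent, (2.4) p.255, (2.7)–(2.8) pp.255–256 (bookkeeping)] -/
theorem gamma_mul_p0Profile_le_tenth {γ A₀ : ℝ} (hγ0 : 0 < γ) (hγh : γ ≤ 1 / 2) (hA : 0 ≤ A₀) (hA' : A₀ ≤ 1 / 16) :
    γ * p0Profile A₀ 1 γ ≤ 1 / 10 := by
  have h := gamma_mul_log_inv_sq_le_one hγ0 hγh
  calc γ * p0Profile A₀ 1 γ = A₀ * (γ * Real.log (γ ^ 2)⁻¹) := by rw [p0Profile, pow_one]; ring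
    _ ≤ A₀ * 1 := mul_le_mul_of_nonneg_left h hA
    _ ≤ 1 / 10 := by linarith

end Numeric

/-! ## §1 ★★★ The Λ-pinned leaf in NODE O's window at the window-edition witness, β letters from stub 3ʷ's box -/

section Window
variable (jM : ℕ) (γ ε₀ ε₂₉ B₃ B₃' a₀ a₁ : ℝ) (lam : ResidW F N) (σ : ∀ P : B12.RunParams, Sit189 F N P.K)
  (s : ∀ P : B12.RunParams, SeqOfRecord F (theta13OfThm1CCMW F N jM γ ε₀ ε₂₉ B₃ B₃' a₀ a₁).ν (theta13OfThm1CCMW F N jM γ ε₀ ε₂₉ B₃ B₃' a₀ a₁).τ9.M (gOfRecord₁₃ F N (theta13OfThm1CCMW F N jM γ ε₀ ε₂₉ B₃ B₃' a₀ a₁) P) P.K (lam.kSel P + 1)) (Nm : B12.RunParams → ℕ) (p₁ : ℕ)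

/-- **★★★ N12's Λ-PINNED ROW IN NODE O's WINDOW AT THE WINDOW-EDITION WITNESS `θ₁₅ᶜᶜᴹ(jM;γ)`, THE β LETTERS FED BY STUB 3ʷ's BOX** — 12I §1 ★★ `…_of_inInterval` (the (2.7)-small-window
form: the flow inputs (2.8a), the coupling step `g_j ≤ g_{j+1} ≤ γ`, `0 ≤ ε_i ≤ 1∕10`, `2 ≤ N₀` and print's first p. 200 condition ALL from the run's window `]0, γ]` + `β ≥ 0` along the history +
`BetaUpperH β′ γ` + `SmallnessFor γ β′ β₀ L p₀`; until now NOT instantiable at any K0 witness because `γ = ½` made `SmallnessFor` unsatisfiable — this seat g5 ∕ dag-n12-e g2) AT dag-n21-c A1ʷ's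
WINDOW EDITION `Θ := theta13OfNumerics … (stage12NumericsOfThm1CCMW F.L jM γ …) …` (whose ₁₃ live re-pin IS `θ₁₅ᶜᶜᴹ(jM;γ)`, `rfl`; K0b's residuals by K0a): `β ≥ 0` along the history ⟸ stub 3ʷ's
LOWER box (`0 ≤ b`, A2ʷ `betaLowerH_theta13OfThm1CCMW_of_half` ∘ dag-n12-e `betaAlongHistory_nonneg_of_betaLowerH` on the run's window), the (2.7) upper bound ⟸ stub 3ʷ's UPPER box (A2ʷ
`betaUpperH_theta13OfThm1CCMW_of_half`), `r = p₀ = 1`, `M = L^{jM} > 0`, `θ.γ = γ` (`rfl`), `A₀ ≥ 0` and `γ·A₀·log γ⁻² ≤ 1∕10` (§0, from `γ ≤ ½`, `A₀ᶜᶜ¹ ≤ 1∕16`) DISCHARGED.  WHAT STAYS DISPLAYED per run: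
live-mass (NODE 00), Prop. 1 at `λ.LF P`, the run's window `hI : Step.InInterval γ (kSel P + 1) g` (= the K1 socket's `Step.InInterval w.γ`, `w.γ ≤ θ.γ = γ`), NODE O's smallness `S` (+ `β₀ ≤ ½`), the levels
`hNN`∕`hNk`, the situation's residual numbers `0 < sh`, `0 ≤ β ≤ ¼`, `2 ≤ L₀`, `L₀² ≤ L`, `0 ≤ O(1)B₃B₅`, `0 ≤ δ`, print's p. 200 conditions `hwin`∕`hMl` (reading `M = L^{jM}`), `Λ ≠ ∅`, the four
ℍ-leaves and (1.80) (N07).  GONE relative to 12I∕12N∕12P's window-free rows at `θ₁₅ᶜ…`: `hflow` (2.8a), `hgpos∕hgstep∕hgle`, `hε0∕hε1`, `hN₀`, `hlog` — the located-input list of N12 at the K0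
witness is the SHORTEST of this lineage.  CONDITIONAL; count-neutral; NOT a discharge of N12.
[cite: Balaban1989LargeFieldI, (0.2)–(0.6) p.176, (1.73) p.192, Prop. 1 (1.78) p.194, (1.80) p.195, (1.82) p.196, (1.89) p.198, (1.91)–(1.102) pp.199–201; Balaban1988Convergent, (2.1) p.254, (2.4)–(2.8) pp.255–256, (2.10)–(2.12) p.256, (2.13) p.257, (3.16)–(3.25) pp.268–270; Balaban1987RG1, Thm 1 p.259, (0.20)–(0.21) p.256, §1 (1.20)–(1.22) p.264; Balaban1989LargeFieldII, (1.4) p.357 (bookkeeping)] -/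
theorem b15Leaf_WOfRecord₁₃_pinAllΛ_N0_theta13OfThm1CCMW_of_massLive_of_inInterval_of_betaBoxW
    -- the witness: NODE O's window `0 < γ ≤ ½` and the weak signs of the [15]∕(2.8) letters (`A₀ ≥ 0`, `A₀ ≤ 1∕16`)
    (hγ0 : 0 < γ) (hγh : γ ≤ 1 / 2) (hwB : 0 ≤ B₃) (hwB' : 0 ≤ B₃') (hwa₀ : 0 ≤ a₀) (hwa₁ : 0 ≤ a₁)
    {P : B12.RunParams} (hK : lam.kSel P < P.K) (hsh : 0 < (σ P).sh)
    {D : Setting189 (F.P P.K) (SU N) (MSField (F.P P.K) (SU N) × ((j : ℕ) → VecField (F.P P.K) j (EuclideanSpace ℝ (Fin (N ^ 2 - 1))))) (Pt (F.P P.K).d)}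
    (hD : D = ((lam.pinRPrime₁₃ (theta13OfThm1CCMW F N jM γ ε₀ ε₂₉ B₃ B₃' a₀ a₁)).pinD189ΛH (theta13OfThm1CCMW F N jM γ ε₀ ε₂₉ B₃ B₃' a₀ a₁).ν (theta13OfThm1CCMW F N jM γ ε₀ ε₂₉ B₃ B₃' a₀ a₁).A₁ (theta13OfThm1CCMW F N jM γ ε₀ ε₂₉ B₃ B₃' a₀ a₁).τ9.M (gOfRecord₁₃ F N (theta13OfThm1CCMW F N jM γ ε₀ ε₂₉ B₃ B₃' a₀ a₁)) σ s Nm p₁).D189 P)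
    (hmassLive : ∀ a, LiveSeq F N (theta13OfThm1CCMW F N jM γ ε₀ ε₂₉ B₃ B₃' a₀ a₁).ν (theta13OfThm1CCMW F N jM γ ε₀ ε₂₉ B₃ B₃' a₀ a₁).τ9 P (gOfRecord₁₃ F N (theta13OfThm1CCMW F N jM γ ε₀ ε₂₉ B₃ B₃' a₀ a₁) P) (lam.kSel P + 1)
        (slotsTOfRecord F N (theta13OfThm1CCMW F N jM γ ε₀ ε₂₉ B₃ B₃' a₀ a₁).ν (theta13OfThm1CCMW F N jM γ ε₀ ε₂₉ B₃ B₃' a₀ a₁).τ9 (EOfRecord₁₃ F N (theta13OfThm1CCMW F N jM γ ε₀ ε₂₉ B₃ B₃' a₀ a₁)) (wOfRecord₉ F N (theta13OfThm1CCMW F N jM γ ε₀ ε₂₉ B₃ B₃' a₀ a₁).toStage9Params)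
          (theta13OfThm1CCMW F N jM γ ε₀ ε₂₉ B₃ B₃' a₀ a₁).ppSel P (gOfRecord₁₃ F N (theta13OfThm1CCMW F N jM γ ε₀ ε₂₉ B₃ B₃' a₀ a₁) P) (lam.kSel P + 1)) a →
      0 < ∫ V, rterm (reprTOfRecord₁₃ F N (theta13OfThm1CCMW F N jM γ ε₀ ε₂₉ B₃ B₃' a₀ a₁) P (lam.kSel P)) a V ∂(fieldMeasure (F.P P.K) (lam.kSel P + 1) (SU N)))
    (hP1 : Prop1Printed (lam.LF P))
    (hNN : (N0OfRecord₁₃ (theta13OfThm1CCMW F N jM γ ε₀ ε₂₉ B₃ B₃' a₀ a₁) P (lam.kSel P + 1)) ≤ Nm P) (hNk : (N0OfRecord₁₃ (theta13OfThm1CCMW F N jM γ ε₀ ε₂₉ B₃ B₃' a₀ a₁) P (lam.kSel P + 1)) ≤ lam.kSel P + 1)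
    (hβ0 : 0 ≤ (σ P).β) (hβ : (σ P).β ≤ 1 / 4) (hL₀ : 2 ≤ (σ P).L₀) (hL₀L : (σ P).L₀ ^ 2 ≤ ((F.P P.K).L : ℝ))
    (hB : 0 ≤ (σ P).O1 * (σ P).B₃ * (σ P).B₅) (hδ : 0 ≤ (σ P).δ)
    (hwin : 4 * (2 + (121 / 120) ^ 2 * ((σ P).O1 * (σ P).B₃ * (σ P).B₅ * ((theta13OfThm1CCMW F N jM γ ε₀ ε₂₉ B₃ B₃' a₀ a₁).τ9.M : ℝ) ^ 5))
      ≤ ((Real.log ((gOfRecord₁₃ F N (theta13OfThm1CCMW F N jM γ ε₀ ε₂₉ B₃ B₃' a₀ a₁) P) (lam.kSel P + 1) ^ 2)⁻¹) ^ (theta13OfThm1CCMW F N jM γ ε₀ ε₂₉ B₃ B₃' a₀ a₁).ν.r) ^ (Real.log ((σ P).L₀ ^ 2) / Real.log ((F.P P.K).L : ℝ)))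
    (hMl : (121 / 120) ^ 2 * ((σ P).O1 * (σ P).B₃ * (σ P).B₅ * ((theta13OfThm1CCMW F N jM γ ε₀ ε₂₉ B₃ B₃' a₀ a₁).τ9.M : ℝ) ^ 5) * Real.exp (-(4 * (σ P).δ * ((theta13OfThm1CCMW F N jM γ ε₀ ε₂₉ B₃ B₃' a₀ a₁).τ9.M : ℝ))) ≤ 1 / 12)
    -- NODE O's window is (2.7)-small for stub 3ʷ's upper-box constant `β'` ([I] §1 p.264 «γ sufficiently small»; displayed)
    {β' β₀ : ℝ} {L : ℕ} (S : SmallnessFor (theta13OfThm1CCMW F N jM γ ε₀ ε₂₉ B₃ B₃' a₀ a₁).γ β' β₀ L (theta13OfThm1CCMW F N jM γ ε₀ ε₂₉ B₃ B₃' a₀ a₁).ν.p₀) (hβ₀ : β₀ ≤ 1 / 2)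
    (hI : Step.InInterval (theta13OfThm1CCMW F N jM γ ε₀ ε₂₉ B₃ B₃' a₀ a₁).γ (lam.kSel P + 1) (gOfRecord₁₃ F N (theta13OfThm1CCMW F N jM γ ε₀ ε₂₉ B₃ B₃' a₀ a₁) P)) 
    -- stub 3ʷ's box at these letters: `0 ≤ b`, the γ-box of `betaOfRecord₁₃ F N θ₁₅ᶜᶜᴹ(jM)` (A1's `½`-member; = the window edition's β on `]0,γ]`, A2ʷ) — feeds `β ≥ 0` along the history AND the (2.7) upper bound
    {b : ℝ} (hb : 0 ≤ b) (hβlo : BetaLowerH b γ (betaOfRecord₁₃ F N (theta13OfThm1CCM F N jM ε₀ ε₂₉ B₃ B₃' a₀ a₁))) (hβhi : BetaUpperH β' γ (betaOfRecord₁₃ F N (theta13OfThm1CCM F N jM ε₀ ε₂₉ B₃ B₃' a₀ a₁)))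
    (hΛ : (((enlD F (theta13OfThm1CCMW F N jM γ ε₀ ε₂₉ B₃ B₃' a₀ a₁).ν (theta13OfThm1CCMW F N jM γ ε₀ ε₂₉ B₃ B₃' a₀ a₁).τ9.M P (gOfRecord₁₃ F N (theta13OfThm1CCMW F N jM γ ε₀ ε₂₉ B₃ B₃' a₀ a₁) P)) 4 (lam.kSel P + 1 + 1 - (N0OfRecord₁₃ (theta13OfThm1CCMW F N jM γ ε₀ ε₂₉ B₃ B₃' a₀ a₁) P (lam.kSel P + 1)))
        (omegaOfChain (s P) (lam.kSel P + 1 + 1 - (N0OfRecord₁₃ (theta13OfThm1CCMW F N jM γ ε₀ ε₂₉ B₃ B₃' a₀ a₁) P (lam.kSel P + 1)))))ᶜ ∩ (σ P).Z).Nonempty)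
    (L91h : ∀ U, new189 D U → ∀ p ∈ plaqsOf (half D),
      Ineq191 (dist1 (plaqHol (D.Upp U) p)) (D.devV'' U p) D.α ((D.L ^ D.h)⁻¹) (D.ε D.h) (E124 D.ε D.L D.η D.k D.h))
    (L95 : ∀ U, new189 D U → ∀ p ∈ plaqsOf (half D),
      Ineq195 (D.devV'' U p) (dist1 (plaqHol (D.Uhalf U (D.boxOf p)) p)) D.α ((D.L ^ D.h)⁻¹) (D.ε D.h) (E124 D.ε D.L D.η D.k D.h))
    (L91 : ∀ U, new189 D U → ∀ j, D.h ≤ j → j ≤ D.k → ∀ p ∈ plaqsOf (dom D j),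
      Ineq191 (dist1 (plaqHol (D.Upp U) p)) (D.dev97 U p) D.α ((D.L ^ j)⁻¹) (D.ε j) (E124 D.ε D.L D.η D.k j))
    (L97 : ∀ U, new189 D U → ∀ j, D.h ≤ j → j ≤ D.k → ∀ p ∈ plaqsOf (dom D j),
      Ineq191 (D.dev97 U p) (D.dev0 U p) D.α ((D.L ^ j)⁻¹) (D.ε j) (E124 D.ε D.L D.η D.k j))
    (L80 : ∀ U, new189 D U → ∀ j, D.h ≤ j → j ≤ D.k → ∀ p ∈ plaqsOf (dom D j),
      Ineq180 (D.dev0 U p) (D.ε D.k) D.η D.B₃ D.B₅ D.M D.δ (D.dist p) D.O1) :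
    B15Leaf (WOfRecord₁₃ F N (theta13OfThm1CCMW F N jM γ ε₀ ε₂₉ B₃ B₃' a₀ a₁)
      ((lam.pinRPrime₁₃ (theta13OfThm1CCMW F N jM γ ε₀ ε₂₉ B₃ B₃' a₀ a₁)).pinD189ΛH (theta13OfThm1CCMW F N jM γ ε₀ ε₂₉ B₃ B₃' a₀ a₁).ν (theta13OfThm1CCMW F N jM γ ε₀ ε₂₉ B₃ B₃' a₀ a₁).A₁ (theta13OfThm1CCMW F N jM γ ε₀ ε₂₉ B₃ B₃' a₀ a₁).τ9.M (gOfRecord₁₃ F N (theta13OfThm1CCMW F N jM γ ε₀ ε₂₉ B₃ B₃' a₀ a₁)) σ s Nm p₁) P) := by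
  -- `A₀ = A₀ᶜᶜ¹ ≤ A₀ᶜ ≤ 1∕16` (K0a FILE 11a∕12a′), so `γ·A₀·log γ⁻² ≤ 1∕10` on `]0, ½]` (§0); `r = p₀ = 1`, `M = L^{jM}`, `θ.γ = γ` by `rfl`
  have hA : 0 ≤ A0OfThm1CC1 F.L B₃ B₃' a₀ a₁ := A0OfThm1CC1_nonneg hwB hwB' hwa₀ hwa₁
  have hA' : A0OfThm1CC1 F.L B₃ B₃' a₀ a₁ ≤ 1 / 16 := (A0OfThm1CC1_le hwB hwB' hwa₀ hwa₁).trans (A0OfThm1C_le_sixteenth hwB)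
  exact b15Leaf_WOfRecord₁₃_pinAllΛ_N0_liveRepin₁₃_of_massLive_of_hasResiduals_of_inInterval
    (theta13OfNumerics F N (stage12NumericsOfThm1CCMW F.L jM γ ε₀ B₃ B₃' a₀ a₁) ε₂₉ (zeta316OfRecord F N (stage12NumericsOfThm1CCMW F.L jM γ ε₀ B₃ B₃' a₀ a₁).ν (stage12NumericsOfThm1CCMW F.L jM γ ε₀ B₃ B₃' a₀ a₁).τ9.M (stage12NumericsOfThm1CCMW F.L jM γ ε₀ B₃ B₃' a₀ a₁).A₁) (RzOfRecord F N) (ZtOfRecord F N)) lam σ s Nm p₁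
    (hasResidualsOfRecord_theta13OfNumerics F N (stage12NumericsOfThm1CCMW F.L jM γ ε₀ B₃ B₃' a₀ a₁) ε₂₉) hK hsh (pow_pos (Nat.zero_lt_of_lt F.hL.2) jM) hD hmassLive hP1 le_rfl hNN hNk hβ0 hβ hL₀ hL₀L hB hδ hwin
    (betaAlongHistory_nonneg_of_betaLowerH hb (betaLowerH_theta13OfThm1CCMW_of_half hγh hβlo) hI) hMl hA S hβ₀
    (gamma_mul_p0Profile_le_tenth hγ0 hγh hA hA') hI (betaUpperH_theta13OfThm1CCMW_of_half hγh hβhi) hΛ L91h L95 L91 L97 L80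

end Window

/-! ## §2 NODE O's window made (2.7)-small explicitly: `SmallnessFor γ β' ½ 2 1` for `0 < γ ≤ e⁻³`, `γ²β' ≤ 1` — and §1 with `S` discharged -/

section SmallWindowExplicit

/-- **THE (2.7)-SMALLNESS STRUCTURE HOLDS ON AN EXPLICIT WINDOW**: for `0 ≤ β'`, `0 < γ ≤ e⁻³` and `γ²·β' ≤ 1`, `B14FlowStep.SmallnessFor γ β' (1∕2) 2 1` (fields: `γ < 1`;
`γ²β' ≤ β₀(2+β₀) = 5∕4` and `≤ 1`; `4·1+2 = 6 ≤ log γ⁻²` and `1 ≤ ½·log γ⁻²` from `log γ⁻² ≥ 6`; block letter `2`, `2·½ ≤ 1`).  The block letter of `SmallnessFor` is free in dag-n12-e's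
(2.7) passage (12I's binder `{L : ℕ}`), so `2` serves.  [cite: Balaban1988Convergent, (2.6)–(2.9) pp.255–256 (the passage «β₀ > 0 arbitrarily small if g is sufficiently small»); Balaban1987RG1, §1 p.264] -/
theorem smallnessFor_half_two_one {γ β' : ℝ} (hγ0 : 0 < γ) (hγe : γ ≤ Real.exp (-3)) (hβ'0 : 0 ≤ β') (hγβ : γ ^ 2 * β' ≤ 1) :
    SmallnessFor γ β' (1 / 2) 2 1 := by
  have hγ1 : γ < 1 := lt_of_le_of_lt hγe (Real.exp_lt_one_iff.mpr (by norm_num))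
  have hlog : 6 ≤ Real.log (γ ^ 2)⁻¹ := by
    have h1 : Real.log (γ ^ 2)⁻¹ = -(2 * Real.log γ) := by rw [Real.log_inv, Real.log_pow]; push_cast; ring
    have h2 : Real.log γ ≤ -3 := by
      have := Real.log_le_log hγ0 hγe
      rwa [Real.log_exp] at this
    rw [h1]; linarith
  refine ⟨hγ0, hγ1, hβ'0, by norm_num, by norm_num, ?_, hγβ, ?_, ?_, le_rfl, by norm_num⟩
  · linarith
  · push_cast; linarith
  · push_cast; linarith

variable (jM : ℕ) (γ ε₀ ε₂₉ B₃ B₃' a₀ a₁ : ℝ) (lam : ResidW F N) (σ : ∀ P : B12.RunParams, Sit189 F N P.K)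
  (s : ∀ P : B12.RunParams, SeqOfRecord F (theta13OfThm1CCMW F N jM γ ε₀ ε₂₉ B₃ B₃' a₀ a₁).ν (theta13OfThm1CCMW F N jM γ ε₀ ε₂₉ B₃ B₃' a₀ a₁).τ9.M (gOfRecord₁₃ F N (theta13OfThm1CCMW F N jM γ ε₀ ε₂₉ B₃ B₃' a₀ a₁) P) P.K (lam.kSel P + 1)) (Nm : B12.RunParams → ℕ) (p₁ : ℕ)

/-- **★★★ §1 WITH NODE O's SMALLNESS `S` DISCHARGED ON THE EXPLICIT WINDOW** `0 < γ ≤ e⁻³`, `γ²·β' ≤ 1` (`β' ≥ 0` stub 3ʷ's upper constant; both follow from the K1 closer's choice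
`γ := min γ₀ (min e⁻³ (1+|β'|)⁻¹)` inside NODE O's window `γ₀`): the located per-run input list of §1 with `S`, `hβ₀` REPLACED by the two arithmetic window bounds.  CONDITIONAL; count-neutral;
NOT a discharge of N12. [cite: Balaban1989LargeFieldI, (0.2)–(0.6) p.176, (1.73) p.192, Prop. 1 (1.78) p.194, (1.80) p.195, (1.89) p.198, (1.91)–(1.102) pp.199–201; Balaban1988Convergent, (2.4)–(2.9) pp.255–256, (3.16)–(3.25) pp.268–270; Balaban1987RG1, Thm 1 p.259, (0.20)–(0.21) p.256, §1 (1.20)–(1.22) p.264 (bookkeeping)] -/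
theorem b15Leaf_WOfRecord₁₃_pinAllΛ_N0_theta13OfThm1CCMW_of_massLive_of_inInterval_of_betaBoxW_of_window
    -- the witness: NODE O's window `0 < γ ≤ ½` and the weak signs of the [15]∕(2.8) letters (`A₀ ≥ 0`, `A₀ ≤ 1∕16`)
    (hγ0 : 0 < γ) (hγh : γ ≤ 1 / 2) (hwB : 0 ≤ B₃) (hwB' : 0 ≤ B₃') (hwa₀ : 0 ≤ a₀) (hwa₁ : 0 ≤ a₁)
    {P : B12.RunParams} (hK : lam.kSel P < P.K) (hsh : 0 < (σ P).sh)
    {D : Setting189 (F.P P.K) (SU N) (MSField (F.P P.K) (SU N) × ((j : ℕ) → VecField (F.P P.K) j (EuclideanSpace ℝ (Fin (N ^ 2 - 1))))) (Pt (F.P P.K).d)}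
    (hD : D = ((lam.pinRPrime₁₃ (theta13OfThm1CCMW F N jM γ ε₀ ε₂₉ B₃ B₃' a₀ a₁)).pinD189ΛH (theta13OfThm1CCMW F N jM γ ε₀ ε₂₉ B₃ B₃' a₀ a₁).ν (theta13OfThm1CCMW F N jM γ ε₀ ε₂₉ B₃ B₃' a₀ a₁).A₁ (theta13OfThm1CCMW F N jM γ ε₀ ε₂₉ B₃ B₃' a₀ a₁).τ9.M (gOfRecord₁₃ F N (theta13OfThm1CCMW F N jM γ ε₀ ε₂₉ B₃ B₃' a₀ a₁)) σ s Nm p₁).D189 P)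
    (hmassLive : ∀ a, LiveSeq F N (theta13OfThm1CCMW F N jM γ ε₀ ε₂₉ B₃ B₃' a₀ a₁).ν (theta13OfThm1CCMW F N jM γ ε₀ ε₂₉ B₃ B₃' a₀ a₁).τ9 P (gOfRecord₁₃ F N (theta13OfThm1CCMW F N jM γ ε₀ ε₂₉ B₃ B₃' a₀ a₁) P) (lam.kSel P + 1)
        (slotsTOfRecord F N (theta13OfThm1CCMW F N jM γ ε₀ ε₂₉ B₃ B₃' a₀ a₁).ν (theta13OfThm1CCMW F N jM γ ε₀ ε₂₉ B₃ B₃' a₀ a₁).τ9 (EOfRecord₁₃ F N (theta13OfThm1CCMW F N jM γ ε₀ ε₂₉ B₃ B₃' a₀ a₁)) (wOfRecord₉ F N (theta13OfThm1CCMW F N jM γ ε₀ ε₂₉ B₃ B₃' a₀ a₁).toStage9Params)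
          (theta13OfThm1CCMW F N jM γ ε₀ ε₂₉ B₃ B₃' a₀ a₁).ppSel P (gOfRecord₁₃ F N (theta13OfThm1CCMW F N jM γ ε₀ ε₂₉ B₃ B₃' a₀ a₁) P) (lam.kSel P + 1)) a →
      0 < ∫ V, rterm (reprTOfRecord₁₃ F N (theta13OfThm1CCMW F N jM γ ε₀ ε₂₉ B₃ B₃' a₀ a₁) P (lam.kSel P)) a V ∂(fieldMeasure (F.P P.K) (lam.kSel P + 1) (SU N)))
    (hP1 : Prop1Printed (lam.LF P))
    (hNN : (N0OfRecord₁₃ (theta13OfThm1CCMW F N jM γ ε₀ ε₂₉ B₃ B₃' a₀ a₁) P (lam.kSel P + 1)) ≤ Nm P) (hNk : (N0OfRecord₁₃ (theta13OfThm1CCMW F N jM γ ε₀ ε₂₉ B₃ B₃' a₀ a₁) P (lam.kSel P + 1)) ≤ lam.kSel P + 1)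
    (hβ0 : 0 ≤ (σ P).β) (hβ : (σ P).β ≤ 1 / 4) (hL₀ : 2 ≤ (σ P).L₀) (hL₀L : (σ P).L₀ ^ 2 ≤ ((F.P P.K).L : ℝ))
    (hB : 0 ≤ (σ P).O1 * (σ P).B₃ * (σ P).B₅) (hδ : 0 ≤ (σ P).δ)
    (hwin : 4 * (2 + (121 / 120) ^ 2 * ((σ P).O1 * (σ P).B₃ * (σ P).B₅ * ((theta13OfThm1CCMW F N jM γ ε₀ ε₂₉ B₃ B₃' a₀ a₁).τ9.M : ℝ) ^ 5))
      ≤ ((Real.log ((gOfRecord₁₃ F N (theta13OfThm1CCMW F N jM γ ε₀ ε₂₉ B₃ B₃' a₀ a₁) P) (lam.kSel P + 1) ^ 2)⁻¹) ^ (theta13OfThm1CCMW F N jM γ ε₀ ε₂₉ B₃ B₃' a₀ a₁).ν.r) ^ (Real.log ((σ P).L₀ ^ 2) / Real.log ((F.P P.K).L : ℝ)))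
    (hMl : (121 / 120) ^ 2 * ((σ P).O1 * (σ P).B₃ * (σ P).B₅ * ((theta13OfThm1CCMW F N jM γ ε₀ ε₂₉ B₃ B₃' a₀ a₁).τ9.M : ℝ) ^ 5) * Real.exp (-(4 * (σ P).δ * ((theta13OfThm1CCMW F N jM γ ε₀ ε₂₉ B₃ B₃' a₀ a₁).τ9.M : ℝ))) ≤ 1 / 12)
    -- NODE O's window made (2.7)-small EXPLICITLY: `γ ≤ e⁻³` and `γ²·β' ≤ 1` for stub 3ʷ's upper-box constant `β' ≥ 0` (§2's `smallnessFor_half_two_one`: `β₀ := ½`, block letter `2`, `p₀ = 1`)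
    {β' : ℝ} (hβ'0 : 0 ≤ β') (hγe : γ ≤ Real.exp (-3)) (hγβ : γ ^ 2 * β' ≤ 1)
    (hI : Step.InInterval (theta13OfThm1CCMW F N jM γ ε₀ ε₂₉ B₃ B₃' a₀ a₁).γ (lam.kSel P + 1) (gOfRecord₁₃ F N (theta13OfThm1CCMW F N jM γ ε₀ ε₂₉ B₃ B₃' a₀ a₁) P)) 
    -- stub 3ʷ's box at these letters: `0 ≤ b`, the γ-box of `betaOfRecord₁₃ F N θ₁₅ᶜᶜᴹ(jM)` (A1's `½`-member; = the window edition's β on `]0,γ]`, A2ʷ) — feeds `β ≥ 0` along the history AND the (2.7) upper bound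
    {b : ℝ} (hb : 0 ≤ b) (hβlo : BetaLowerH b γ (betaOfRecord₁₃ F N (theta13OfThm1CCM F N jM ε₀ ε₂₉ B₃ B₃' a₀ a₁))) (hβhi : BetaUpperH β' γ (betaOfRecord₁₃ F N (theta13OfThm1CCM F N jM ε₀ ε₂₉ B₃ B₃' a₀ a₁)))
    (hΛ : (((enlD F (theta13OfThm1CCMW F N jM γ ε₀ ε₂₉ B₃ B₃' a₀ a₁).ν (theta13OfThm1CCMW F N jM γ ε₀ ε₂₉ B₃ B₃' a₀ a₁).τ9.M P (gOfRecord₁₃ F N (theta13OfThm1CCMW F N jM γ ε₀ ε₂₉ B₃ B₃' a₀ a₁) P)) 4 (lam.kSel P + 1 + 1 - (N0OfRecord₁₃ (theta13OfThm1CCMW F N jM γ ε₀ ε₂₉ B₃ B₃' a₀ a₁) P (lam.kSel P + 1)))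
        (omegaOfChain (s P) (lam.kSel P + 1 + 1 - (N0OfRecord₁₃ (theta13OfThm1CCMW F N jM γ ε₀ ε₂₉ B₃ B₃' a₀ a₁) P (lam.kSel P + 1)))))ᶜ ∩ (σ P).Z).Nonempty)
    (L91h : ∀ U, new189 D U → ∀ p ∈ plaqsOf (half D),
      Ineq191 (dist1 (plaqHol (D.Upp U) p)) (D.devV'' U p) D.α ((D.L ^ D.h)⁻¹) (D.ε D.h) (E124 D.ε D.L D.η D.k D.h))
    (L95 : ∀ U, new189 D U → ∀ p ∈ plaqsOf (half D),
      Ineq195 (D.devV'' U p) (dist1 (plaqHol (D.Uhalf U (D.boxOf p)) p)) D.α ((D.L ^ D.h)⁻¹) (D.ε D.h) (E124 D.ε D.L D.η D.k D.h))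
    (L91 : ∀ U, new189 D U → ∀ j, D.h ≤ j → j ≤ D.k → ∀ p ∈ plaqsOf (dom D j),
      Ineq191 (dist1 (plaqHol (D.Upp U) p)) (D.dev97 U p) D.α ((D.L ^ j)⁻¹) (D.ε j) (E124 D.ε D.L D.η D.k j))
    (L97 : ∀ U, new189 D U → ∀ j, D.h ≤ j → j ≤ D.k → ∀ p ∈ plaqsOf (dom D j),
      Ineq191 (D.dev97 U p) (D.dev0 U p) D.α ((D.L ^ j)⁻¹) (D.ε j) (E124 D.ε D.L D.η D.k j))
    (L80 : ∀ U, new189 D U → ∀ j, D.h ≤ j → j ≤ D.k → ∀ p ∈ plaqsOf (dom D j),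
      Ineq180 (D.dev0 U p) (D.ε D.k) D.η D.B₃ D.B₅ D.M D.δ (D.dist p) D.O1) :
    B15Leaf (WOfRecord₁₃ F N (theta13OfThm1CCMW F N jM γ ε₀ ε₂₉ B₃ B₃' a₀ a₁)
      ((lam.pinRPrime₁₃ (theta13OfThm1CCMW F N jM γ ε₀ ε₂₉ B₃ B₃' a₀ a₁)).pinD189ΛH (theta13OfThm1CCMW F N jM γ ε₀ ε₂₉ B₃ B₃' a₀ a₁).ν (theta13OfThm1CCMW F N jM γ ε₀ ε₂₉ B₃ B₃' a₀ a₁).A₁ (theta13OfThm1CCMW F N jM γ ε₀ ε₂₉ B₃ B₃' a₀ a₁).τ9.M (gOfRecord₁₃ F N (theta13OfThm1CCMW F N jM γ ε₀ ε₂₉ B₃ B₃' a₀ a₁)) σ s Nm p₁) P) :=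
  b15Leaf_WOfRecord₁₃_pinAllΛ_N0_theta13OfThm1CCMW_of_massLive_of_inInterval_of_betaBoxW jM γ ε₀ ε₂₉ B₃ B₃' a₀ a₁ lam σ s Nm p₁
    (S := smallnessFor_half_two_one hγ0 hγe hβ'0 hγβ) (hβ₀ := by norm_num)
    (hγ0 := hγ0) (hγh := hγh) (hwB := hwB) (hwB' := hwB') (hwa₀ := hwa₀) (hwa₁ := hwa₁) (hK := hK) (hsh := hsh) (hD := hD) (hmassLive := hmassLive)
    (hP1 := hP1) (hNN := hNN) (hNk := hNk) (hβ0 := hβ0) (hβ := hβ) (hL₀ := hL₀) (hL₀L := hL₀L) (hB := hB) (hδ := hδ) (hwin := hwin)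
    (hMl := hMl) (hI := hI) (hb := hb) (hβlo := hβlo) (hβhi := hβhi) (hΛ := hΛ) (L91h := L91h) (L95 := L95) (L91 := L91) (L97 := L97)
    (L80 := L80)

end SmallWindowExplicit

/-! ## §3 (v1.2) The EFFECTIVE window of §1 in kernel form — `S` forces `γ ≤ e⁻³`; §1 with the `½`-binders discharged from `S` — and two errata

ERRATA to the module docstring and to §1∕§2 (referee ref-F READ-399, author NITs, recorded here because the file is append-only):
**(NIT-W0)** wherever §0–§2 say «NODE O's window `0 < γ ≤ ½`» (title l.6, the `-- the witness …` binder comments of §1∕§2), the binder `hγh : γ ≤ ½` is ONLY the reach of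
dag-n21-c A2ʷ's `_of_half` transfers and of §0's numeric fact; the EFFECTIVE window of §1 is set by its displayed smallness `S : SmallnessFor γ β′ β₀ L 1`, whose field `h27a`
(`4p + 2 ≤ log γ⁻²` at `p = p₀ = 1`) forces `γ ≤ e⁻³ ≈ 0.0498` (`gamma_le_exp_neg_three_of_smallnessFor_one` below); §1 is therefore contentful exactly on `]0, e⁻³]` (where §2's
`smallnessFor_half_two_one` inhabits `S`) and VACUOUS on `(e⁻³, ½]` (`not_smallnessFor_one_of_exp_neg_three_lt`; at `γ ≥ ½` dag-n12-e's `not_smallnessFor_of_half_le`) — the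
★ theorem of this section is §1 with BOTH window binders `hγ0`, `hγh` DISCHARGED from `S`, so that no binder of N12's row suggests `½` as the reach.  **(NIT-L1)** in the
`Sources` paragraph and the `[cite:]` lists of §1, «(2.10)–(2.13) p.256» of [Balaban1988Convergent] should read «(2.10)–(2.12) p.256, (2.13) p.257» (corrected IN PLACE in v1.4, together with «[Balaban1987RG1] Thm 1 p.255» → «p.259», ref-J READ-152 NIT-1).  Count-neutral; nothing of
Bałaban's asserted; N12 NOT discharged. -/

section EffectiveWindow

/-- **REACH OF `SmallnessFor`, general exponent**: `SmallnessFor γ β′ β₀ L p` forces `γ ≤ e^{−(2p+1)}` (field `h27a`: `4p + 2 ≤ log γ⁻² = −2·log γ`, `γ > 0`). [folklore] -/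
theorem gamma_le_exp_neg_of_smallnessFor {γ β' β₀ : ℝ} {L p : ℕ} (S : SmallnessFor γ β' β₀ L p) :
    γ ≤ Real.exp (-(2 * (p : ℝ) + 1)) := by
  have hγ0 := S.γ_pos
  have h1 : Real.log (γ ^ 2)⁻¹ = -(2 * Real.log γ) := by rw [Real.log_inv, Real.log_pow]; push_cast; ring
  have h2 : Real.log γ ≤ -(2 * (p : ℝ) + 1) := by have := S.h27a; rw [h1] at this; linarith
  exact (Real.log_le_iff_le_exp hγ0).mp h2

/-- **REACH OF `SmallnessFor` AT `p₀ = 1`** (N12's exponent of record, `ν.p₀ = 1`): `SmallnessFor γ β′ β₀ L 1` forces `γ ≤ e⁻³`. [folklore] -/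
theorem gamma_le_exp_neg_three_of_smallnessFor_one {γ β' β₀ : ℝ} {L : ℕ} (S : SmallnessFor γ β' β₀ L 1) : γ ≤ Real.exp (-3) := by
  calc γ ≤ Real.exp (-(2 * ((1 : ℕ) : ℝ) + 1)) := gamma_le_exp_neg_of_smallnessFor S
    _ = Real.exp (-3) := by norm_num

/-- `e⁻³ < ½` (indeed `e⁻³ < e⁻¹ = 1∕e < 1∕2` since `e > 2`). [folklore] -/
theorem exp_neg_three_lt_half : Real.exp (-3) < 1 / 2 := by
  have h1 : Real.exp (-3) < Real.exp (-1) := Real.exp_lt_exp.mpr (by norm_num)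
  have he : (2 : ℝ) < Real.exp 1 := by have := Real.exp_one_gt_d9; linarith
  have h2 : Real.exp (-1) < 1 / 2 := by
    rw [Real.exp_neg, inv_eq_one_div]
    exact one_div_lt_one_div_of_lt (by norm_num) he
  exact h1.trans h2

/-- **NO `SmallnessFor γ β′ β₀ L 1` ABOVE `e⁻³`**: for `e⁻³ < γ` the (2.7)-smallness structure at `p = 1` is uninhabited (whatever `β′ β₀ L`) — the converse of §2's
`smallnessFor_half_two_one`; §1's effective window is `]0, e⁻³]`.  SHARPENS dag-n12-e's `B15Claim189PrintedConditions.not_smallnessFor_of_half_le` (`γ ≥ ½`, every `p`; the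
kernel form of the «unsatisfiable at `γ = ½`» reach note re-derived by three referee probes — ref-F E4, ref-K E3, ref-I) from the edge `½` down to the true threshold `e⁻³`. [folklore] -/
theorem not_smallnessFor_one_of_exp_neg_three_lt {γ β' β₀ : ℝ} {L : ℕ} (h : Real.exp (-3) < γ) : ¬ SmallnessFor γ β' β₀ L 1 :=
  fun S => not_lt.mpr (gamma_le_exp_neg_three_of_smallnessFor_one S) h

variable (jM : ℕ) (γ ε₀ ε₂₉ B₃ B₃' a₀ a₁ : ℝ) (lam : ResidW F N) (σ : ∀ P : B12.RunParams, Sit189 F N P.K)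
  (s : ∀ P : B12.RunParams, SeqOfRecord F (theta13OfThm1CCMW F N jM γ ε₀ ε₂₉ B₃ B₃' a₀ a₁).ν (theta13OfThm1CCMW F N jM γ ε₀ ε₂₉ B₃ B₃' a₀ a₁).τ9.M (gOfRecord₁₃ F N (theta13OfThm1CCMW F N jM γ ε₀ ε₂₉ B₃ B₃' a₀ a₁) P) P.K (lam.kSel P + 1)) (Nm : B12.RunParams → ℕ) (p₁ : ℕ)

/-- **★ §1 WITH ITS WINDOW BINDERS `hγ0 : 0 < γ`, `hγh : γ ≤ ½` DISCHARGED FROM THE DISPLAYED SMALLNESS `S`** (`S.γ_pos`; `gamma_le_exp_neg_three_of_smallnessFor_one S` and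
`exp_neg_three_lt_half`; `θ.γ = γ`, `ν.p₀ = 1` by `rfl`): the same conclusion and the same located per-run list as §1, whose ONLY statement about the size of NODE O's window is now
`S` itself (effective reach `]0, e⁻³]`, §2∕§3).  CONDITIONAL; count-neutral; NOT a discharge of N12.
[cite: Balaban1989LargeFieldI, (0.2)–(0.6) p.176, (1.73) p.192, Prop. 1 (1.78) p.194, (1.80) p.195, (1.82) p.196, (1.89) p.198, (1.91)–(1.102) pp.199–201; Balaban1988Convergent, (2.1) p.254, (2.4)–(2.8) pp.255–256, (2.10)–(2.12) p.256, (2.13) p.257, (3.16)–(3.25) pp.268–270; Balaban1987RG1, Thm 1 p.259, (0.20)–(0.21) p.256, §1 (1.20)–(1.22) p.264; Balaban1989LargeFieldII, (1.4) p.357 (bookkeeping)] -/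
theorem b15Leaf_WOfRecord₁₃_pinAllΛ_N0_theta13OfThm1CCMW_of_massLive_of_inInterval_of_betaBoxW_of_smallness
    -- the witness: the weak signs of the [15]∕(2.8) letters (`A₀ ≥ 0`, `A₀ ≤ 1∕16`); NO window binder — the window is `S`'s
    (hwB : 0 ≤ B₃) (hwB' : 0 ≤ B₃') (hwa₀ : 0 ≤ a₀) (hwa₁ : 0 ≤ a₁)
    {P : B12.RunParams} (hK : lam.kSel P < P.K) (hsh : 0 < (σ P).sh)
    {D : Setting189 (F.P P.K) (SU N) (MSField (F.P P.K) (SU N) × ((j : ℕ) → VecField (F.P P.K) j (EuclideanSpace ℝ (Fin (N ^ 2 - 1))))) (Pt (F.P P.K).d)}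
    (hD : D = ((lam.pinRPrime₁₃ (theta13OfThm1CCMW F N jM γ ε₀ ε₂₉ B₃ B₃' a₀ a₁)).pinD189ΛH (theta13OfThm1CCMW F N jM γ ε₀ ε₂₉ B₃ B₃' a₀ a₁).ν (theta13OfThm1CCMW F N jM γ ε₀ ε₂₉ B₃ B₃' a₀ a₁).A₁ (theta13OfThm1CCMW F N jM γ ε₀ ε₂₉ B₃ B₃' a₀ a₁).τ9.M (gOfRecord₁₃ F N (theta13OfThm1CCMW F N jM γ ε₀ ε₂₉ B₃ B₃' a₀ a₁)) σ s Nm p₁).D189 P)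
    (hmassLive : ∀ a, LiveSeq F N (theta13OfThm1CCMW F N jM γ ε₀ ε₂₉ B₃ B₃' a₀ a₁).ν (theta13OfThm1CCMW F N jM γ ε₀ ε₂₉ B₃ B₃' a₀ a₁).τ9 P (gOfRecord₁₃ F N (theta13OfThm1CCMW F N jM γ ε₀ ε₂₉ B₃ B₃' a₀ a₁) P) (lam.kSel P + 1)
        (slotsTOfRecord F N (theta13OfThm1CCMW F N jM γ ε₀ ε₂₉ B₃ B₃' a₀ a₁).ν (theta13OfThm1CCMW F N jM γ ε₀ ε₂₉ B₃ B₃' a₀ a₁).τ9 (EOfRecord₁₃ F N (theta13OfThm1CCMW F N jM γ ε₀ ε₂₉ B₃ B₃' a₀ a₁)) (wOfRecord₉ F N (theta13OfThm1CCMW F N jM γ ε₀ ε₂₉ B₃ B₃' a₀ a₁).toStage9Params)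
          (theta13OfThm1CCMW F N jM γ ε₀ ε₂₉ B₃ B₃' a₀ a₁).ppSel P (gOfRecord₁₃ F N (theta13OfThm1CCMW F N jM γ ε₀ ε₂₉ B₃ B₃' a₀ a₁) P) (lam.kSel P + 1)) a →
      0 < ∫ V, rterm (reprTOfRecord₁₃ F N (theta13OfThm1CCMW F N jM γ ε₀ ε₂₉ B₃ B₃' a₀ a₁) P (lam.kSel P)) a V ∂(fieldMeasure (F.P P.K) (lam.kSel P + 1) (SU N)))
    (hP1 : Prop1Printed (lam.LF P))
    (hNN : (N0OfRecord₁₃ (theta13OfThm1CCMW F N jM γ ε₀ ε₂₉ B₃ B₃' a₀ a₁) P (lam.kSel P + 1)) ≤ Nm P) (hNk : (N0OfRecord₁₃ (theta13OfThm1CCMW F N jM γ ε₀ ε₂₉ B₃ B₃' a₀ a₁) P (lam.kSel P + 1)) ≤ lam.kSel P + 1)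
    (hβ0 : 0 ≤ (σ P).β) (hβ : (σ P).β ≤ 1 / 4) (hL₀ : 2 ≤ (σ P).L₀) (hL₀L : (σ P).L₀ ^ 2 ≤ ((F.P P.K).L : ℝ))
    (hB : 0 ≤ (σ P).O1 * (σ P).B₃ * (σ P).B₅) (hδ : 0 ≤ (σ P).δ)
    (hwin : 4 * (2 + (121 / 120) ^ 2 * ((σ P).O1 * (σ P).B₃ * (σ P).B₅ * ((theta13OfThm1CCMW F N jM γ ε₀ ε₂₉ B₃ B₃' a₀ a₁).τ9.M : ℝ) ^ 5))
      ≤ ((Real.log ((gOfRecord₁₃ F N (theta13OfThm1CCMW F N jM γ ε₀ ε₂₉ B₃ B₃' a₀ a₁) P) (lam.kSel P + 1) ^ 2)⁻¹) ^ (theta13OfThm1CCMW F N jM γ ε₀ ε₂₉ B₃ B₃' a₀ a₁).ν.r) ^ (Real.log ((σ P).L₀ ^ 2) / Real.log ((F.P P.K).L : ℝ)))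
    (hMl : (121 / 120) ^ 2 * ((σ P).O1 * (σ P).B₃ * (σ P).B₅ * ((theta13OfThm1CCMW F N jM γ ε₀ ε₂₉ B₃ B₃' a₀ a₁).τ9.M : ℝ) ^ 5) * Real.exp (-(4 * (σ P).δ * ((theta13OfThm1CCMW F N jM γ ε₀ ε₂₉ B₃ B₃' a₀ a₁).τ9.M : ℝ))) ≤ 1 / 12)
    -- NODE O's (2.7)-smallness for stub 3ʷ's upper-box constant `β'` — THE window statement of this row (forces `0 < γ ≤ e⁻³`, §3)
    {β' β₀ : ℝ} {L : ℕ} (S : SmallnessFor (theta13OfThm1CCMW F N jM γ ε₀ ε₂₉ B₃ B₃' a₀ a₁).γ β' β₀ L (theta13OfThm1CCMW F N jM γ ε₀ ε₂₉ B₃ B₃' a₀ a₁).ν.p₀) (hβ₀ : β₀ ≤ 1 / 2)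
    (hI : Step.InInterval (theta13OfThm1CCMW F N jM γ ε₀ ε₂₉ B₃ B₃' a₀ a₁).γ (lam.kSel P + 1) (gOfRecord₁₃ F N (theta13OfThm1CCMW F N jM γ ε₀ ε₂₉ B₃ B₃' a₀ a₁) P))
    -- stub 3ʷ's box at these letters: `0 ≤ b`, the γ-box of `betaOfRecord₁₃ F N θ₁₅ᶜᶜᴹ(jM)` — feeds `β ≥ 0` along the history AND the (2.7) upper bound
    {b : ℝ} (hb : 0 ≤ b) (hβlo : BetaLowerH b γ (betaOfRecord₁₃ F N (theta13OfThm1CCM F N jM ε₀ ε₂₉ B₃ B₃' a₀ a₁))) (hβhi : BetaUpperH β' γ (betaOfRecord₁₃ F N (theta13OfThm1CCM F N jM ε₀ ε₂₉ B₃ B₃' a₀ a₁)))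
    (hΛ : (((enlD F (theta13OfThm1CCMW F N jM γ ε₀ ε₂₉ B₃ B₃' a₀ a₁).ν (theta13OfThm1CCMW F N jM γ ε₀ ε₂₉ B₃ B₃' a₀ a₁).τ9.M P (gOfRecord₁₃ F N (theta13OfThm1CCMW F N jM γ ε₀ ε₂₉ B₃ B₃' a₀ a₁) P)) 4 (lam.kSel P + 1 + 1 - (N0OfRecord₁₃ (theta13OfThm1CCMW F N jM γ ε₀ ε₂₉ B₃ B₃' a₀ a₁) P (lam.kSel P + 1)))
        (omegaOfChain (s P) (lam.kSel P + 1 + 1 - (N0OfRecord₁₃ (theta13OfThm1CCMW F N jM γ ε₀ ε₂₉ B₃ B₃' a₀ a₁) P (lam.kSel P + 1)))))ᶜ ∩ (σ P).Z).Nonempty)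
    (L91h : ∀ U, new189 D U → ∀ p ∈ plaqsOf (half D),
      Ineq191 (dist1 (plaqHol (D.Upp U) p)) (D.devV'' U p) D.α ((D.L ^ D.h)⁻¹) (D.ε D.h) (E124 D.ε D.L D.η D.k D.h))
    (L95 : ∀ U, new189 D U → ∀ p ∈ plaqsOf (half D),
      Ineq195 (D.devV'' U p) (dist1 (plaqHol (D.Uhalf U (D.boxOf p)) p)) D.α ((D.L ^ D.h)⁻¹) (D.ε D.h) (E124 D.ε D.L D.η D.k D.h))
    (L91 : ∀ U, new189 D U → ∀ j, D.h ≤ j → j ≤ D.k → ∀ p ∈ plaqsOf (dom D j),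
      Ineq191 (dist1 (plaqHol (D.Upp U) p)) (D.dev97 U p) D.α ((D.L ^ j)⁻¹) (D.ε j) (E124 D.ε D.L D.η D.k j))
    (L97 : ∀ U, new189 D U → ∀ j, D.h ≤ j → j ≤ D.k → ∀ p ∈ plaqsOf (dom D j),
      Ineq191 (D.dev97 U p) (D.dev0 U p) D.α ((D.L ^ j)⁻¹) (D.ε j) (E124 D.ε D.L D.η D.k j))
    (L80 : ∀ U, new189 D U → ∀ j, D.h ≤ j → j ≤ D.k → ∀ p ∈ plaqsOf (dom D j),
      Ineq180 (D.dev0 U p) (D.ε D.k) D.η D.B₃ D.B₅ D.M D.δ (D.dist p) D.O1) :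
    B15Leaf (WOfRecord₁₃ F N (theta13OfThm1CCMW F N jM γ ε₀ ε₂₉ B₃ B₃' a₀ a₁)
      ((lam.pinRPrime₁₃ (theta13OfThm1CCMW F N jM γ ε₀ ε₂₉ B₃ B₃' a₀ a₁)).pinD189ΛH (theta13OfThm1CCMW F N jM γ ε₀ ε₂₉ B₃ B₃' a₀ a₁).ν (theta13OfThm1CCMW F N jM γ ε₀ ε₂₉ B₃ B₃' a₀ a₁).A₁ (theta13OfThm1CCMW F N jM γ ε₀ ε₂₉ B₃ B₃' a₀ a₁).τ9.M (gOfRecord₁₃ F N (theta13OfThm1CCMW F N jM γ ε₀ ε₂₉ B₃ B₃' a₀ a₁)) σ s Nm p₁) P) :=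
  -- `S` is literally `SmallnessFor γ β' β₀ L 1` (`θ.γ = γ`, `ν.p₀ = 1` by `rfl`), whence `0 < γ ≤ e⁻³ < ½`
  have S₁ : SmallnessFor γ β' β₀ L 1 := S
  b15Leaf_WOfRecord₁₃_pinAllΛ_N0_theta13OfThm1CCMW_of_massLive_of_inInterval_of_betaBoxW jM γ ε₀ ε₂₉ B₃ B₃' a₀ a₁ lam σ s Nm p₁
    S₁.γ_pos ((gamma_le_exp_neg_three_of_smallnessFor_one S₁).trans exp_neg_three_lt_half.le) hwB hwB' hwa₀ hwa₁ hK hsh hD hmassLive hP1 hNN hNk hβ0 hβ hL₀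
    hL₀L hB hδ hwin hMl S hβ₀ hI hb hβlo hβhi hΛ L91h L95 L91 L97 L80

end EffectiveWindow

/-! ## §4 (v1.3) Print's FIRST p. 200 CONDITION `hwin` OF THE (1.89) ROWS FROM THE RUN's WINDOW — the per-run display `4(2 + (121∕120)²·O(1)B₃B₅M⁵) ≤ ((log g_{k+1}⁻²)^r)^{log L₀²∕log L}`
(12P ∕ F1 ∕ 12Zᴬ-b ∕ B's `hwin`, which READS the run's coupling `g_{k+1}`) follows from the run's window `0 < g_{k+1} ≤ γ` (the row's own `hI`) and the RUN-INDEPENDENT window letter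
`C ≤ (log γ⁻²)^{log L₀²∕log L}` — a third numeric window choice of the closer (after `γ ≤ e⁻³` and `β′γ² ≤ ¾`), so at the witness N12's located per-run list keeps `hwin` only in the form of
its situation numbers -/

section P200Window

/-- Monotonicity behind (1.100)'s window form: for `0 ≤ Γ ≤ Γ'` with `1 ≤ Γ'`, `1 ≤ r`, `0 ≤ e` and `C ≤ Γ^e`, also `C ≤ ((Γ')^r)^e` (`x ↦ x^e` and `x ↦ x^r` monotone, `Γ' ≤ Γ'^r`; the log-monotonicity step is `B14FlowStep.log_inv_sq_mono`). [folklore] -/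
theorem le_pow_rpow_of_le_rpow {C Γ Γ' e : ℝ} {r : ℕ} (hr : 1 ≤ r) (he : 0 ≤ e) (hΓ0 : 0 ≤ Γ) (hΓ1 : 1 ≤ Γ') (hΓ : Γ ≤ Γ') (hC : C ≤ Γ ^ e) :
    C ≤ (Γ' ^ r) ^ e := by
  have h1 : Γ ^ e ≤ Γ' ^ e := Real.rpow_le_rpow hΓ0 hΓ he
  have h2 : Γ' ≤ Γ' ^ r := le_self_pow₀ hΓ1 (by omega)
  have h3 : Γ' ^ e ≤ (Γ' ^ r) ^ e := Real.rpow_le_rpow (by linarith) h2 he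
  exact hC.trans (h1.trans h3)

/-- `6 ≤ log γ⁻²` on the window `0 < γ ≤ e⁻³`. [folklore] -/
theorem six_le_log_inv_sq {γ : ℝ} (hγ0 : 0 < γ) (hγe : γ ≤ Real.exp (-3)) : 6 ≤ Real.log (γ ^ 2)⁻¹ := by
  have h1 : Real.log (γ ^ 2)⁻¹ = -(2 * Real.log γ) := by rw [Real.log_inv, Real.log_pow]; push_cast; ring
  have h2 : Real.log γ ≤ -3 := by
    have := Real.log_le_log hγ0 hγe
    rwa [Real.log_exp] at this
  rw [h1]; linarith

/-- **★ PRINT's FIRST p. 200 CONDITION FROM THE WINDOW** ([Balaban1989LargeFieldI] p.200, the condition on `M` under (1.99)–(1.100), in the typed shape of dag-n12-e's ∕ this seat's `hwin`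
row): in a run with `Step.InInterval γ K g` and `k ≤ K`, on the window `γ ≤ e⁻³`, for situation numbers `1 ≤ L₀`, `1 ≤ L` and any `1 ≤ r`, the RUN-INDEPENDENT letter
`C ≤ (log γ⁻²)^{log L₀²∕log L}` gives the row `C ≤ ((log g_k⁻²)^r)^{log L₀²∕log L}`.  USE (K1⁷ closer, at 12Zᴬ-b ∕ B ∕ F1's `hwin` binder, `C := 4(2 + (121∕120)²·O(1)B₃B₅M⁵)`,
`r := ν.r = 1`, `L := (F.P P.K).L`, `L₀ := (σ P).L₀`): `fun P hk => hwin_of_inInterval (hI P hk) le_rfl hγe le_rfl hL₀' hL' (hC P hk)` — the run's coupling no longer appears in what the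
closer supplies for this row; only the window choice `γ ≤ exp (−½·C^{log L∕log L₀²})` (equivalent form) does.  Bookkeeping; count-neutral; NOT a discharge of N12.
[cite: Balaban1989LargeFieldI, (1.99)–(1.100) p.200, (1.89) p.198; Balaban1987RG1, Thm 1 p.259 (the interval `]0, γ]`) (bookkeeping)] -/
theorem hwin_of_inInterval {γ : ℝ} {K k : ℕ} {g : ℕ → ℝ} (hI : Step.InInterval γ K g) (hk : k ≤ K) (hγe : γ ≤ Real.exp (-3))
    {C L₀ L : ℝ} {r : ℕ} (hr : 1 ≤ r) (hL₀ : 1 ≤ L₀) (hL : 1 ≤ L)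
    (hC : C ≤ (Real.log (γ ^ 2)⁻¹) ^ (Real.log (L₀ ^ 2) / Real.log L)) :
    C ≤ ((Real.log ((g k) ^ 2)⁻¹) ^ r) ^ (Real.log (L₀ ^ 2) / Real.log L) := by
  obtain ⟨hg0, hgγ⟩ := hI k hk
  have hγ0 : 0 < γ := hg0.trans_le hgγ
  have h6 := six_le_log_inv_sq hγ0 hγe
  have he : 0 ≤ Real.log (L₀ ^ 2) / Real.log L := div_nonneg (Real.log_nonneg (one_le_pow₀ hL₀)) (Real.log_nonneg hL)
  exact le_pow_rpow_of_le_rpow hr he (by linarith) (by linarith [B14FlowStep.log_inv_sq_mono hg0 hgγ]) (B14FlowStep.log_inv_sq_mono hg0 hgγ) hC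

end P200Window

end Summit.QuantumFields.YangMills.BalabanUVNodes.N12AtTheta13OfThm1CCMWSmallWindow
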